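import Summits.BirchSwinnertonDyer.BirchSwinnertonDyer.Theorems.PrintCf2SplitBadTwoAdditiveAtSeven
import Summits.BirchSwinnertonDyer.BirchSwinnertonDyer.Theorems.PrintCf2SplitBadTwoFramePinningDeuring
import Literature.NumberTheory.DiophantineGeometry.LocalReductionFiniteBadPlacesProofs
import Literature.NumberTheory.DiophantineGeometry.LocalReductionIsIntegralAtProofs
import Literature.NumberTheory.DiophantineGeometry.LocalReductionProofs
import Literature.NumberTheory.EllipticCurves.LocalEulerFactorModel
import HarnessLib

/-!
# Crux `PrintCf2.SplitBadTwoRankOneOfFacts` (stmt-BirchSwinnertonDyer-20368), road α v9.1 — brick B16 file 6 (class facts):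
# REDUCTION TYPES of `W_K`, `C • W = cm7^{(d)}`, at the odd places: GOOD off `14d`, ADDITIVE above the odd `ℓ ∣ d` (for `K ∋ √−7`)

Cell `bsd-print-cf2`, width seat `bsd-line-cf2-p1-w3` g7 (prover-bsd-line-cf2-p1-w3-g7-0); `--supports stmt-BirchSwinnertonDyer-20368` (helper,
Theses-free). HONEST FRAMING: nothing here closes the crux or a registered stub; BSD is not proved by any of this; no summit statement is
proved by this seat. No definition, no named fact, no `sorry`.

WHAT. The two class facts that make the finite set `T = {v̄} ∪ {w ∣ 7d}` admissible in the cokernel bound of file 4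
(`relIndex_image_endInvariants_le_prod_card_localKer`) on the S3c₂ frames of road α (`C • W = cm7^{(d)}`, `d` squarefree, `K` imaginary
quadratic with `θ² = −7`):
* §1 **`hasGoodReductionAt_baseChange_of_smul_eq_cm7Twist`** — for EVERY number field `K` and every finite place `w` with `14d ∉ w`:
  `W_K` has GOOD reduction at `w` (the integral model `cm7^{(d)}`, `Δ = −7³·d⁶`, is a `w`-adic unit model; LEAD g11's transport engine
  `valuation_algebraMap_eq_pow_ramificationIdx` + the tree's `hasGoodReductionAt_of_valuation_Δ_eq_one_holds` and
  `hasGoodReductionAt_smul_iff_holds`). With file 3: the local kernel of control VANISHES at every such `w ∤ 2`.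
* §2 **`hasAdditiveReductionAt_baseChange_of_smul_eq_cm7Twist_of_dvd`** — for `K` imaginary quadratic with `θ² = −7` (so `d_K = −7`),
  `d` squarefree, `ℓ` an odd prime `≠ 7` dividing `d` and `w ∣ ℓ`: `W_K` has ADDITIVE reduction at `w` (`ord_ℓ Δ(cm7^{(d)}) = 6`,
  `ord_ℓ c₄ ≥ 2`, and `e(w|ℓ) = 1` because `e = 2` would force `ℓ ∣ d_K = −7` — tree `natGenerator_dvd_discr_of_ramificationIdx_eq_two`,
  `IsCMFieldOfJ.discr_eq`; then LEAD g11's engine `hasAdditiveReductionAt_baseChange_of_integral_model`). With file 2: the local kernel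
  of control at every such `w` has at most `2` elements.
presearch: Silverman AEC VII.5.1, X.5.4; Dedekind's discriminant theorem — standard; tree engines cited above. beyond-print theorem: no.

References: [SilvermanAEC2009] VII.1 Rem. 1.1, VII.5 Prop. 5.1, X.5 Prop. 5.4; [NeukirchANT1999] III §2 Cor. (2.12); [SilvermanATAEC1994]
App. A §3 (row D = −7).
-/

noncomputable section

open scoped Classical

set_option linter.dupNamespace false
set_option autoImplicit false

open NumberField IsDedekindDomain Field WeierstrassCurve
open Literature.NumberTheory.EllipticCurves
open Literature.NumberTheory.GaloisRepresentations
open Summit.BirchSwinnertonDyer.BirchSwinnertonDyer.Theorems.PrintCf2.AdditiveAtSeven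
open Summit.BirchSwinnertonDyer.BirchSwinnertonDyer.Theorems.PrintCf2.FramePinning

universe u

namespace Summit.BirchSwinnertonDyer.BirchSwinnertonDyer.Theorems.PrintCf2.ReductionTypesOverK

open Rat.HeightOneSpectrum

variable (K : Type) [Field K] [NumberField K] (w : HeightOneSpectrum (𝓞 K))

/-! ## §0. Arithmetic of the integral twist model `cm7^{(d)}` at an odd rational place -/

/-- `c₄(cm7) = 105`. [cite: SilvermanATAEC1994, App. A §3 (row D = −7)] -/
theorem c₄_cm7 : cm7.c₄ = 105 := by
  norm_num [cm7, WeierstrassCurve.c₄, WeierstrassCurve.b₂, WeierstrassCurve.b₄]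

/-- The rational prime below `w` lies in `w`. [folklore] -/
theorem natCast_natGenerator_mem : ((natGenerator (w.under (𝓞 ℚ)) : ℕ) : 𝓞 K) ∈ w.asIdeal := by
  have h : ((natGenerator (w.under (𝓞 ℚ)) : ℕ) : 𝓞 ℚ) ∈ (w.under (𝓞 ℚ)).asIdeal :=
    (Rat.natCast_mem_asIdeal_iff _).mpr dvd_rfl
  have h' : algebraMap (𝓞 ℚ) (𝓞 K) ((natGenerator (w.under (𝓞 ℚ)) : ℕ) : 𝓞 ℚ) ∈ w.asIdeal := h
  rwa [map_natCast] at h'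

/-- If the integer `N` is not in `w` then the rational prime below `w` does not divide `N`. [folklore] -/
theorem not_natGenerator_dvd_of_intCast_notMem {N : ℤ} (hN : ((N : ℤ) : 𝓞 K) ∉ w.asIdeal) :
    ¬ ((natGenerator (w.under (𝓞 ℚ)) : ℕ) : ℤ) ∣ N := by
  rintro ⟨k, rfl⟩
  apply hN
  have h := w.asIdeal.mul_mem_right ((k : ℤ) : 𝓞 K) (natCast_natGenerator_mem K w)
  push_cast at h ⊢
  exact h

/-! ## §1. `W_K` has GOOD reduction at every place `w` with `14d ∉ w` -/

/-- **GOOD REDUCTION OFF `14d`.** `W/ℚ` elliptic with `C • W = cm7^{(d)}`, `d ≠ 0`, `K` ANY number field, `w` a finite place with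
`(14d : 𝓞 K) ∉ w`: `W_K` has good reduction at `w` (the integral model `cm7^{(d)}` has `w`-integral coefficients and unit
discriminant `−7³d⁶` at `w`). [cite: SilvermanAEC2009, VII.1 Rem. 1.1 and VII.5 Prop. 5.1(a)] [cite: SilvermanATAEC1994, App. A §3] -/
theorem hasGoodReductionAt_baseChange_of_smul_eq_cm7Twist {d : ℤ} (hd0 : d ≠ 0) (W : WeierstrassCurve ℚ) [W.IsElliptic]
    (C : VariableChange ℚ) (hC : C • W = cm7.quadraticTwist (d : ℚ))
    (h14d : (((14 * d : ℤ) : ℤ) : 𝓞 K) ∉ w.asIdeal) :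
    (W.baseChange K).HasGoodReductionAt w := by
  set v := w.under (𝓞 ℚ) with hv
  set ℓ : ℕ := natGenerator v with hℓ
  set e := w.asIdeal.ramificationIdx (𝓞 ℚ) with he
  set M := cm7.quadraticTwist (d : ℚ) with hM
  have hdQ : (d : ℚ) ≠ 0 := by exact_mod_cast hd0
  haveI hMell : M.IsElliptic := cm7.isElliptic_quadraticTwist hdQ
  have hndvd : ¬ ((ℓ : ℕ) : ℤ) ∣ 14 * d := not_natGenerator_dvd_of_intCast_notMem K w h14d
  have hℓp : Nat.Prime ℓ := prime_natGenerator v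
  have hp2 : ℓ ≠ 2 := fun h ↦ hndvd ⟨7 * d, by rw [h]; push_cast; ring⟩
  have h7 : ¬ ((ℓ : ℕ) : ℤ) ∣ 7 := fun h ↦ hndvd (by
    rw [show (14 : ℤ) * d = 2 * 7 * d by ring]
    exact (h.mul_left 2).mul_right d)
  have hd : ¬ ((ℓ : ℕ) : ℤ) ∣ d := fun h ↦ hndvd (dvd_mul_of_dvd_right h 14)
  -- valuations over `ℚ`
  have hval : ∀ x : ℚ, w.valuation K (algebraMap ℚ K x) = v.valuation ℚ x ^ e :=
    valuation_algebraMap_eq_pow_ramificationIdx K w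
  obtain ⟨h₂, h₄, h₆⟩ := valuation_quadraticTwist_le_one_of_odd cm7 (B₂ := -3) (B₄ := -4) (B₆ := -4)
      (by norm_num [cm7, WeierstrassCurve.b₂]) (by norm_num [cm7, WeierstrassCurve.b₄])
      (by norm_num [cm7, WeierstrassCurve.b₆]) v hp2 d
  have hvd : v.valuation ℚ (d : ℚ) = 1 := Rat.valuation_intCast_eq_one v hd
  have hv7 : v.valuation ℚ ((-(7 ^ 3) : ℤ) : ℚ) = 1 := by
    refine Rat.valuation_intCast_eq_one v fun h ↦ h7 ?_
    rw [dvd_neg] at h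
    exact (Nat.prime_iff_prime_int.mp hℓp).dvd_of_dvd_pow h
  have hcast : (-7 ^ 3 : ℚ) = ((-(7 ^ 3) : ℤ) : ℚ) := by push_cast; ring
  have hvΔ : v.valuation ℚ M.Δ = 1 := by
    rw [hM, quadraticTwist_Δ, Δ_cm7, Valuation.map_mul, Valuation.map_pow, hvd, one_pow, one_mul, hcast, hv7]
  -- the base-changed model is `w`-integral with unit discriminant
  have hint : (M.baseChange K).IsIntegralAt w := by
    rw [isIntegralAt_iff_valuation_le_one]
    refine ⟨?_, ?_, ?_, ?_, ?_⟩
    · rw [baseChange, map_a₁, hM, quadraticTwist_a₁, map_zero, Valuation.map_zero]; exact zero_le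
    · simp only [baseChange, map_a₂, hval]; exact pow_le_one' h₂ e
    · rw [baseChange, map_a₃, hM, quadraticTwist_a₃, map_zero, Valuation.map_zero]; exact zero_le
    · simp only [baseChange, map_a₄, hval]; exact pow_le_one' h₄ e
    · simp only [baseChange, map_a₆, hval]; exact pow_le_one' h₆ e
  have hΔK : w.valuation K (M.baseChange K).Δ = 1 := by
    rw [baseChange, map_Δ, hval, hvΔ, one_pow]
  have hgoodM : (M.baseChange K).HasGoodReductionAt w :=
    hasGoodReductionAt_of_valuation_Δ_eq_one_holds w (M.baseChange K) hint hΔK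
  -- transfer along `C • W = M`
  haveI : (W.baseChange K).IsElliptic := by rw [baseChange]; infer_instance
  have hsmul : (C.map (algebraMap ℚ K)) • (W.baseChange K) = M.baseChange K := by
    rw [← hC, baseChange, baseChange, map_variableChange]
  rw [← hsmul] at hgoodM
  exact (hasGoodReductionAt_smul_iff_holds w (W.baseChange K) (C.map (algebraMap ℚ K))).mp hgoodM

/-! ## §2. `W_K` has ADDITIVE reduction above the odd primes `ℓ ∣ d`, `ℓ ≠ 7`, when `K ∋ √−7` -/

/-- **`d_K = −7` for the frame field**: `K` imaginary quadratic containing `θ` with `θ² = −7` has discriminant `−7` (the CM field of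
`j = −3375`, tree `IsCMFieldOfJ.discr_eq`). [cite: Cox2013, §7.B] -/
theorem discr_eq_neg_seven_of_sq_eq (hK : IsImaginaryQuadratic K) {θ : K} (hθ : θ ^ 2 = -7) {d : ℤ} (hd0 : d ≠ 0)
    (W : WeierstrassCurve ℚ) [W.IsElliptic] {C : VariableChange ℚ} (hC : C • W = cm7.quadraticTwist (d : ℚ)) :
    NumberField.discr K = -7 := by
  obtain ⟨-, hjm, hcd, -, -⟩ := cm_data_of_smul_eq_cm7Twist W hd0 hC
  have hcm : IsCMFieldOfJ K W.j := ⟨hK.1, θ, by rw [hcd]; push_cast; exact hθ⟩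
  rw [IsCMFieldOfJ.discr_eq hjm hcm, hcd]

/-- **`e(w|ℓ) = 1` at every odd `ℓ ≠ 7` for the frame field** (`d_K = −7`; `e = 2` would force `ℓ ∣ d_K`, tree
`natGenerator_dvd_discr_of_ramificationIdx_eq_two`; `e ≤ [K:ℚ] = 2`, `e ≠ 0`). [cite: NeukirchANT1999, III §2 Cor. (2.12)] -/
theorem ramificationIdx_eq_one_of_frame (hK : IsImaginaryQuadratic K) {θ : K} (hθ : θ ^ 2 = -7) {d : ℤ} (hd0 : d ≠ 0)
    (W : WeierstrassCurve ℚ) [W.IsElliptic] {C : VariableChange ℚ} (hC : C • W = cm7.quadraticTwist (d : ℚ))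
    (h7 : natGenerator (w.under (𝓞 ℚ)) ≠ 7) :
    w.asIdeal.ramificationIdx (𝓞 ℚ) = 1 := by
  set v := w.under (𝓞 ℚ) with hv
  haveI : w.asIdeal.LiesOver v.asIdeal := ⟨rfl⟩
  haveI : NoZeroSMulDivisors (𝓞 ℚ) (𝓞 K) := ⟨fun {c x} h ↦ by
    rw [Algebra.smul_def, mul_eq_zero] at h
    exact h.imp_left fun hc ↦ FaithfulSMul.algebraMap_injective (𝓞 ℚ) (𝓞 K) (by rw [hc, map_zero])⟩
  have hle : w.asIdeal.ramificationIdx (𝓞 ℚ) ≤ Module.finrank ℚ K := by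
    rw [← Ideal.ramificationIdx'_eq_ramificationIdx v.asIdeal w.asIdeal v.ne_bot]
    exact Ideal.ramificationIdx_le_finrank (𝓞 K) ℚ K w.asIdeal (p := v.asIdeal)
  have hne : w.asIdeal.ramificationIdx (𝓞 ℚ) ≠ 0 := by
    rw [← Ideal.ramificationIdx'_eq_ramificationIdx v.asIdeal w.asIdeal v.ne_bot]
    exact Ideal.IsDedekindDomain.ramificationIdx'_ne_zero_of_liesOver w.asIdeal v.ne_bot
  have hne2 : w.asIdeal.ramificationIdx (𝓞 ℚ) ≠ 2 := fun he ↦ by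
    have hdvd := natGenerator_dvd_discr_of_ramificationIdx_eq_two K w he
    rw [discr_eq_neg_seven_of_sq_eq K hK hθ hd0 W hC] at hdvd
    have h7' : ((natGenerator v : ℕ) : ℤ) ∣ 7 := by
      have : (-7 : ℤ) = -(7 : ℤ) := rfl
      rw [dvd_neg] at hdvd
      exact hdvd
    exact h7 ((Nat.prime_dvd_prime_iff_eq (prime_natGenerator v) (by norm_num)).mp (by exact_mod_cast h7'))
  rw [hK.1] at hle
  omega

/-- **ADDITIVE REDUCTION ABOVE THE ODD PRIMES `ℓ ∣ d`, `ℓ ≠ 7`, OVER THE FRAME FIELD.** `W/ℚ` elliptic with `C • W = cm7^{(d)}`, `d`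
squarefree, `K` imaginary quadratic with `θ² = −7`, `ℓ` a prime with `ℓ ≠ 2, 7`, `ℓ ∣ d`, `w ∣ ℓ`: `W_K` is ADDITIVE at `w`
(`ord_ℓ Δ(cm7^{(d)}) = 6`, `ord_ℓ c₄ ≥ 2`, `e(w|ℓ) = 1`, so `ord_w Δ = 6 ∉ 12ℤ` with `|c₄|_w³ ≤ |Δ|_w`; LEAD g11's engine
`hasAdditiveReductionAt_baseChange_of_integral_model`). [cite: SilvermanAEC2009, VII.5 Prop. 5.1(c) and X.5 Prop. 5.4] -/
theorem hasAdditiveReductionAt_baseChange_of_smul_eq_cm7Twist_of_dvd {d : ℤ} (hd0 : d ≠ 0) (hsq : Squarefree d)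
    (W : WeierstrassCurve ℚ) [W.IsElliptic] (C : VariableChange ℚ) (hC : C • W = cm7.quadraticTwist (d : ℚ))
    (hK : IsImaginaryQuadratic K) {θ : K} (hθ : θ ^ 2 = -7) {ℓ : ℕ} (hℓ : ℓ.Prime) (hℓ2 : ℓ ≠ 2) (hℓ7 : ℓ ≠ 7)
    (hℓd : (ℓ : ℤ) ∣ d) (hw : ((ℓ : ℕ) : 𝓞 K) ∈ w.asIdeal) :
    (W.baseChange K).HasAdditiveReductionAt w := by
  set v := w.under (𝓞 ℚ) with hv
  -- the prime below `w` is `ℓ`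
  have hℓv : ((ℓ : ℕ) : 𝓞 ℚ) ∈ v.asIdeal := by
    change algebraMap (𝓞 ℚ) (𝓞 K) ((ℓ : ℕ) : 𝓞 ℚ) ∈ w.asIdeal
    rwa [map_natCast]
  have hgen : natGenerator v = ℓ :=
    (Nat.prime_dvd_prime_iff_eq (prime_natGenerator v) hℓ).mp ((Rat.natCast_mem_asIdeal_iff _).mp hℓv)
  have hp2 : natGenerator v ≠ 2 := by rw [hgen]; exact hℓ2
  have he : w.asIdeal.ramificationIdx (𝓞 ℚ) = 1 :=
    ramificationIdx_eq_one_of_frame K w hK hθ hd0 W hC (by rw [hgen]; exact hℓ7)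
  -- `d = ℓ · d₀`, `ℓ ∤ d₀`
  obtain ⟨d₀, rfl⟩ := hℓd
  have hd₀ : ¬ ((natGenerator v : ℕ) : ℤ) ∣ d₀ := by
    rw [hgen]
    rintro ⟨k, rfl⟩
    have h := hsq (ℓ : ℤ) ⟨k, by ring⟩
    rw [Int.isUnit_iff] at h
    rcases h with h | h
    · exact hℓ.one_lt.ne' (by exact_mod_cast h)
    · have : (0 : ℤ) ≤ ℓ := by positivity
      omega
  have hvd : v.valuation ℚ (((ℓ : ℤ) * d₀ : ℤ) : ℚ) = WithZero.exp (-(1 : ℤ)) := by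
    have h := Rat.valuation_pow_mul_intCast v hd₀ 1
    rw [hgen, pow_one] at h
    push_cast at h ⊢
    exact h
  have h7 : ¬ ((natGenerator v : ℕ) : ℤ) ∣ 7 := by
    rw [hgen]
    intro h
    exact hℓ7 ((Nat.prime_dvd_prime_iff_eq hℓ (by norm_num)).mp (by exact_mod_cast h))
  have hv7 : v.valuation ℚ ((-(7 ^ 3) : ℤ) : ℚ) = 1 := by
    refine Rat.valuation_intCast_eq_one v fun h ↦ h7 ?_
    rw [dvd_neg] at h
    exact (Nat.prime_iff_prime_int.mp (prime_natGenerator v)).dvd_of_dvd_pow h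
  have hcast : (-7 ^ 3 : ℚ) = ((-(7 ^ 3) : ℤ) : ℚ) := by push_cast; ring
  set M := cm7.quadraticTwist (((ℓ : ℤ) * d₀ : ℤ) : ℚ) with hM
  obtain ⟨h₂, h₄, h₆⟩ := valuation_quadraticTwist_le_one_of_odd cm7 (B₂ := -3) (B₄ := -4) (B₆ := -4)
      (by norm_num [cm7, WeierstrassCurve.b₂]) (by norm_num [cm7, WeierstrassCurve.b₄])
      (by norm_num [cm7, WeierstrassCurve.b₆]) v hp2 ((ℓ : ℤ) * d₀)
  have hΔ : v.valuation ℚ M.Δ = WithZero.exp (-((6 : ℕ) : ℤ)) := by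
    rw [hM, quadraticTwist_Δ, Δ_cm7, Valuation.map_mul, Valuation.map_pow, hvd, ← WithZero.exp_nsmul, hcast, hv7,
      mul_one]
    congr 1
  have hc₄ : v.valuation ℚ M.c₄ ^ 3 ≤ v.valuation ℚ M.Δ := by
    rw [hΔ, hM, quadraticTwist_c₄, c₄_cm7, Valuation.map_mul, Valuation.map_pow, hvd, mul_pow, ← pow_mul,
      ← WithZero.exp_nsmul]
    have h105 : v.valuation ℚ (105 : ℚ) ≤ 1 := by exact_mod_cast Rat.valuation_intCast_le_one v 105
    calc WithZero.exp ((2 * 3 : ℕ) • (-(1 : ℤ))) * v.valuation ℚ (105 : ℚ) ^ 3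
        ≤ WithZero.exp ((2 * 3 : ℕ) • (-(1 : ℤ))) * 1 := mul_le_mul' le_rfl (pow_le_one' h105 3)
      _ = WithZero.exp (-((6 : ℕ) : ℤ)) := by rw [mul_one]; congr 1
  have hn : ¬ 12 ∣ w.asIdeal.ramificationIdx (𝓞 ℚ) * 6 := by rw [he]; decide
  exact hasAdditiveReductionAt_baseChange_of_integral_model K w W M C hC
    (by rw [hM, quadraticTwist_a₁, Valuation.map_zero]; exact zero_le)
    h₂ (by rw [hM, quadraticTwist_a₃, Valuation.map_zero]; exact zero_le) h₄ h₆ hΔ hn hc₄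

end Summit.BirchSwinnertonDyer.BirchSwinnertonDyer.Theorems.PrintCf2.ReductionTypesOverK

end
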